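import Summits.Ventures.PercRepro.RankLevelSetFrameQ
import Summits.Ventures.PercRepro.GenQTopWitness

/-!
# PercRepro — C-025 at `(q + 2, q)` on EVERY finite matroid for EVERY `q`, from the re-cut per-flat residues
(night-4, gen 0)

night-1's `rls_succ_all` (`RankLevelSetFrameQ.lean`) is the `|E|`-induction wrapper at level `q + 1` for every
`p ≥ q + 3` and needs its core at every such `p`.  On the DIAGONAL `p = q + 3` the wrapper closes with less:
the parallel step uses the previous diagonal `(q + 2, q)`, the coloop step reduces to the trivial pair
`(q + 2, q + 1)` (`RLS_of_le`), and the truncation case is the core itself.  `rls_diag` is that specialisation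
(proof: night-1's, mutatis mutandis, on the landed lemmas `RLS_of_loop_q`, `RLS_of_parallel_q`, `RLS_of_coloop_q`,
`truncate_*`, `rls_of_truncate`).  With `rls_succ_succ_of_residueBelow` (`GenQTopWitness.lean`: the core of the
`(q + 2, q)` row from the balance on `𝔉` at the types `t ≤ q − 1`) this gives, by induction on `q` from Theorem N
at `(4, 2)`:

* **`rls_succ_succ_all`** — for every `q ≥ 2`, if `PerFlatResidueBelow q′` holds for every `3 ≤ q′ ≤ q`, then
  `RLS M (q + 2) q` holds on every finite matroid — THE GENERAL `(q + 2, q)` ROW REDUCED TO THE PER-FLAT RESIDUES,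
  kernel-checked; each residue is a finite per-flat statement on the family `𝔉` (two hyperplane traces + two
  points) at the types `t ≤ q − 1`.

At `q = 3` the only residue is `PerFlatResidueBelow 3` (the `(5, 3)` row is Theorem O, so it is implied); at
`q = 4` the residues are levels `3` and `4` (level `4` = `TypeThreeSmall ∧ TwentyOnePrime` by
`rls_six_four_of_typeThree`, which uses Theorem O for the parallel step instead).
-/

open scoped Matroid

namespace PercRepro.GenQ

open Finset ThmH ThmN

variable {α : Type}

/-- **The diagonal wrapper** (night-1's `rls_succ_all` at `p = q + 3` only): `C025` at `(q + 2, q)` on every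
finite matroid and the simple, rank-`(q + 3)`, coloop-free core at `(q + 3, q + 1)` give `C025` at
`(q + 3, q + 1)` on every finite matroid. -/
theorem rls_diag (q : ℕ)
    (hprev : ∀ (M : Matroid α) [M.Finite], RLS M (q + 2) q)
    (hcore : ∀ (M : Matroid α) [M.Finite],
      (∀ e ∈ M.E, ∀ f ∈ M.E, e ≠ f → M.eRk {e, f} = 2) → M.eRank = ((q + 3 : ℕ) : ℕ∞) →
      (∀ e, ¬ M.IsColoop e) → RLS M (q + 3) (q + 1)) :
    ∀ (M : Matroid α) [M.Finite], RLS M (q + 3) (q + 1) := by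
  suffices H : ∀ n : ℕ, ∀ (M : Matroid α) [M.Finite], M.E.ncard = n → RLS M (q + 3) (q + 1) from
    fun M _ => H _ M rfl
  intro n
  induction n using Nat.strong_induction_on with
  | _ n ih =>
  intro M _ hn
  classical
  have hdel : ∀ e ∈ M.E, (M ＼ {e}).E.ncard < n := by
    intro e he
    rw [_root_.Matroid.delete_ground, ← hn, ← Set.ncard_sdiff_singleton_add_one he M.ground_finite]
    omega
  -- Case 1: a loop
  by_cases hL : ∃ e ∈ M.E, M.IsLoop e
  · obtain ⟨e, he, hloopE⟩ := hL
    exact RLS_of_loop_q M hloopE (q + 3) (q + 1) (ih _ (hdel e he) (M ＼ {e}) rfl)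
  push Not at hL
  -- Case 2: a parallel pair
  by_cases hP : ∃ e ∈ M.E, ∃ e' ∈ M.E, e' ≠ e ∧ e ∈ M.closure {e'}
  · obtain ⟨e, he, e', he', hne, hpar⟩ := hP
    have heI : M.Indep {e} :=
      _root_.Matroid.indep_singleton.2 ((_root_.Matroid.not_isLoop_iff he).1 (hL e he))
    exact RLS_of_parallel_q M (p := q + 2) (q := q) heI he' hne hpar (ih _ (hdel e he) (M ＼ {e}) rfl)
      (hprev (M ／ {e}))
  push Not at hP
  -- Case 3: simple
  have hs : ∀ e ∈ M.E, ∀ f ∈ M.E, e ≠ f → M.eRk {e, f} = 2 :=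
    fun e he f hf hef => eRk_pair_eq_two_of_simple M hL (fun e he e' he' hne => hP e he e' he' hne) he hf hef
  rcases lt_trichotomy M.eRank ((q + 3 : ℕ) : ℕ∞) with hlt | heq | hgt
  · exact RLS_of_eRank_lt M hlt
  · -- `r(E) = q + 3`
    by_cases hC : ∃ e, M.IsColoop e
    · obtain ⟨e, hcol⟩ := hC
      refine RLS_of_coloop_q M (p := q + 2) (q := q) (by omega) hcol heq ?_
      exact RLS_of_le (M ＼ {e}) (by omega)
    · push Not at hC
      exact hcore M hs heq hC
  · -- `r(E) > q + 3`: truncate to rank `q + 3`, which is simple, of rank `q + 3` and coloop-free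
    have hTs := truncate_pair_eRk M (p := q + 3) (by omega) hs
    have hTR := truncate_eRank_eq M hgt
    have hTc := truncate_no_coloop M hgt
    have hT : RLS (Matroid.truncate M (q + 3)) (q + 3) (q + 1) := hcore _ hTs hTR hTc
    unfold RLS at hT ⊢
    exact Matroid.rls_of_truncate M (q + 3) (by omega) (phiK (q + 3) (q + 1)) (by unfold phiK; positivity) hT

/-- **The `(q + 2, q)` row on every finite matroid for every `q ≥ 2` from the re-cut per-flat residues**: if
`PerFlatResidueBelow q′` holds for every `3 ≤ q′ ≤ q`, then `RLS M (q + 2) q` for every finite matroid `M`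
(induction on `q` from Theorem N at `(4, 2)`; the step is `rls_diag` with the core `rls_succ_succ_of_residueBelow`). -/
theorem rls_succ_succ_all (q : ℕ) (hq : 2 ≤ q)
    (hres : ∀ q', 3 ≤ q' → q' ≤ q → PerFlatResidueBelow q') :
    ∀ (M : Matroid α) [M.Finite], RLS M (q + 2) q := by
  classical
  induction q, hq using Nat.le_induction with
  | base => exact fun M _ => c025_two_all M 4 le_rfl
  | succ k hk ih =>
    have hprev : ∀ (M : Matroid α) [M.Finite], RLS M (k + 2) k :=
      ih (fun q' h3 hq' => hres q' h3 (by omega))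
    have hres' : PerFlatResidueBelow (k + 1) := hres (k + 1) (by omega) le_rfl
    intro M _
    have := rls_diag k hprev (fun M _ hs hR hcol =>
      rls_succ_succ_of_residueBelow (k + 1) (by omega) hres' M hs (by rw [hR]) (fun _ => hcol)) M
    exact this

end PercRepro.GenQ
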